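import Summits.RiemannHypothesis.RiemannHypothesis.Theorems.SoloInformedGroundStatePairing

/-!
# Ground-state endgame, V-b: the polarisation bootstrap

Solo programme `solo-RiemannHypothesis-informed`, session 3 (part 2 of the operator-free endgame;
part 1 is `SoloInformedGroundStatePairing.lean`, part 3 `SoloInformedGroundStateVisibility.lean`).
Everything here is proved, with no named fact as hypothesis.

**The mechanism.**  Let `k` be a test vector on the window `[-a, a]` whose `ℓ¹` zero sum
`Z₁(k; T) = Σ_{0<|Im ρ|≤T} m(ρ)|k̂(ρ)|` is at most `A` for all `T`; write `E(a) = e^{a/2} √(2a)`.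
For every test `g` on the window, polarising `Q(g) = Q(k + (g-k))` (`weilQuadratic_add`) and
evaluating the two cross terms ON THE ZERO SIDE of the explicit formula (part 1,
`norm_weilFunctional_cross_le`) gives the **polarisation inequality**
`Re Q(g) ≥ Re Q(g-k) − A·E(a)·(‖k‖₂ + 2‖g-k‖₂)` (`re_weilQuadratic_ge_polarisation`).
Since `g - k` is again a test on the window, `Re Q(g-k) ≥ ε(a) ‖g-k‖₂²` BY DEFINITION of the
ground energy `ε(a) = weilGroundEnergy a`; for a normalised `g` with `Re Q(g) ≤ ε(a) + s` this is
the **bootstrap** `ε(a)(1 − ‖g-k‖₂²) ≥ −(A·E(a)·(‖k‖₂ + 2‖g-k‖₂) + s)`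
(`weilGroundEnergy_bootstrap_of_near_minimiser`), and letting `g` run through a minimising
sequence converging in `L²` to a ground state `u`, `Δ := ‖u-k‖₂`,
`ε(a) (1 − Δ²) ≥ −A·E(a)·(‖k‖₂ + 2Δ)` (`weilGroundEnergy_bootstrap_of_groundState`).
The crude floor `ε(a) ≥ −C(1+a)e^{a}` never enters: the ground energy bounds ITSELF.  Consequences:
`Δ < 1 ⇒ ε(a) ≥ −A E(a)(‖k‖₂+2Δ)/(1−Δ²)` (`weilGroundEnergy_ge_of_groundState`), and conversely
`ε(a) < 0 ⇒ Δ² ≥ 1 − A E(a)(‖k‖₂+2Δ)/|ε(a)|` (`one_sub_le_dist_sq_of_weilGroundEnergy_neg`):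
off-line zeros make the ground state *invisible* from the near-null vectors of the zero pairing.
-/

noncomputable section

open Complex Filter Set Topology Metric MeasureTheory
open Literature.NumberTheory.LFunctions
open scoped ComplexConjugate

namespace Summit.RiemannHypothesis.RiemannHypothesis.Theorems

/-! ## (N) The polarisation bootstrap -/

section Bootstrap

variable {g k u : ℝ → ℂ} {a A : ℝ}

/-- The difference of two functions supported in the window is supported in the window. -/
theorem tsupport_sub_subset_Icc (hgs : tsupport g ⊆ Icc (-a) a) (hks : tsupport k ⊆ Icc (-a) a) :
    tsupport (g - k) ⊆ Icc (-a) a := by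
  have e : g - k = fun t ↦ g t + (-k) t := by
    funext t
    simp [sub_eq_add_neg]
  rw [e]
  refine (tsupport_add g (-k)).trans (union_subset hgs ?_)
  rw [tsupport, Function.support_neg]
  exact hks

/-- **Polarisation inequality.** For tests `g, k` on `[-a, a]`, `k` with `Z₁(k; ·) ≤ A`:
`Re Q(g) ≥ Re Q(g − k) − A e^{a/2}√(2a) (‖k‖₂ + 2‖g − k‖₂)`
(`Q(k + d) = Q(k) + Q(d) + W(k ⋆ d̃) + W(d ⋆ k̃)`, `d = g - k`, and the `ℓ¹` bounds of part 1). -/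
theorem re_weilQuadratic_ge_polarisation (hg : IsWeilTest g) (hk : IsWeilTest k)
    (hks : tsupport k ⊆ Icc (-a) a) (hgs : tsupport g ⊆ Icc (-a) a) (ha : 0 ≤ a)
    (hA : ∀ T : ℝ,
      ∑ᶠ ρ ∈ weilZeroIndex T, (riemannZetaZeroOrder ρ : ℝ) * ‖weilMellin k ρ‖ ≤ A) :
    (weilQuadratic (g - k)).re - A * (Real.exp (a / 2) * Real.sqrt (2 * a)) *
        (Real.sqrt (∫ t, ‖k t‖ ^ 2) + 2 * Real.sqrt (∫ t, ‖g t - k t‖ ^ 2)) ≤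
      (weilQuadratic g).re := by
  have hd : IsWeilTest (g - k) := hg.sub hk
  have hds : tsupport (g - k) ⊆ Icc (-a) a := tsupport_sub_subset_Icc hgs hks
  have hsum : g = k + (g - k) := by abel
  have hQ := weilQuadratic_add hk hd
  rw [← hsum] at hQ
  obtain ⟨h1, h2⟩ := norm_weilFunctional_cross_le hk hd hds ha hA
  have h3 := norm_weilQuadratic_le_of_zeroSumAbs_le hk hks ha hA
  simp only [Pi.sub_apply] at h1 h2
  have hre : (weilQuadratic g).re = (weilQuadratic k).re + (weilQuadratic (g - k)).re +
      ((weilFunctional (weilConv k (weilReflect (g - k)))).re +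
        (weilFunctional (weilConv (g - k) (weilReflect k))).re) := by
    rw [hQ]
    simp only [Complex.add_re]
  have b1 := (abs_le.1 ((Complex.abs_re_le_norm _).trans h1)).1
  have b2 := (abs_le.1 ((Complex.abs_re_le_norm _).trans h2)).1
  have b3 := (abs_le.1 ((Complex.abs_re_le_norm _).trans h3)).1
  rw [hre]
  nlinarith [b1, b2, b3]

/-- **Bootstrap from a near-minimiser (no ground state needed).** Let `0 < a`, `g` a test on
`[-a, a]` with `Re Q(g) ≤ ε(a) + s` (for `‖g‖₂ = 1` this says `g` is an `s`-near minimiser), and `k`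
a test on the window with `Z₁(k; ·) ≤ A`.  Then, with `D = ‖g − k‖₂²`,
`ε(a) (1 − D) ≥ −(A e^{a/2}√(2a)(‖k‖₂ + 2√D) + s)`: indeed `Re Q(g − k) ≥ ε(a) D` by definition of
`ε(a)`, and the polarisation inequality. -/
theorem weilGroundEnergy_bootstrap_of_near_minimiser (hg : IsWeilTest g)
    (hgs : tsupport g ⊆ Icc (-a) a) (ha : 0 ≤ a) {s : ℝ}
    (hgap : (weilQuadratic g).re ≤ weilGroundEnergy a + s) (hk : IsWeilTest k)
    (hks : tsupport k ⊆ Icc (-a) a) (hA : ∀ T : ℝ,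
      ∑ᶠ ρ ∈ weilZeroIndex T, (riemannZetaZeroOrder ρ : ℝ) * ‖weilMellin k ρ‖ ≤ A) :
    -(A * (Real.exp (a / 2) * Real.sqrt (2 * a)) *
        (Real.sqrt (∫ t, ‖k t‖ ^ 2) + 2 * Real.sqrt (∫ t, ‖g t - k t‖ ^ 2)) + s) ≤
      weilGroundEnergy a * (1 - ∫ t, ‖g t - k t‖ ^ 2) := by
  have hpol := re_weilQuadratic_ge_polarisation hg hk hks hgs ha hA
  have hd : IsWeilTest (g - k) := hg.sub hk
  have hds : tsupport (g - k) ⊆ Icc (-a) a := tsupport_sub_subset_Icc hgs hks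
  have hlow := mul_integral_le_weilQuadratic_of_le_weilGroundEnergy le_rfl hd hds
  simp only [Pi.sub_apply] at hlow
  have e : weilGroundEnergy a * (1 - ∫ t, ‖g t - k t‖ ^ 2) =
      weilGroundEnergy a - weilGroundEnergy a * ∫ t, ‖g t - k t‖ ^ 2 := by ring
  rw [e]
  linarith

/-- Solved form: if moreover `D = ‖g − k‖₂² < 1`, then
`ε(a) ≥ −(A e^{a/2}√(2a)(‖k‖₂ + 2√D) + s)/(1 − D)`. -/
theorem weilGroundEnergy_ge_of_near_minimiser (hg : IsWeilTest g)
    (hgs : tsupport g ⊆ Icc (-a) a) (ha : 0 ≤ a) {s : ℝ}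
    (hgap : (weilQuadratic g).re ≤ weilGroundEnergy a + s) (hk : IsWeilTest k)
    (hks : tsupport k ⊆ Icc (-a) a) (hA : ∀ T : ℝ,
      ∑ᶠ ρ ∈ weilZeroIndex T, (riemannZetaZeroOrder ρ : ℝ) * ‖weilMellin k ρ‖ ≤ A)
    (hD : ∫ t, ‖g t - k t‖ ^ 2 < 1) :
    -((A * (Real.exp (a / 2) * Real.sqrt (2 * a)) *
        (Real.sqrt (∫ t, ‖k t‖ ^ 2) + 2 * Real.sqrt (∫ t, ‖g t - k t‖ ^ 2)) + s) /
        (1 - ∫ t, ‖g t - k t‖ ^ 2)) ≤ weilGroundEnergy a := by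
  have h := weilGroundEnergy_bootstrap_of_near_minimiser hg hgs ha hgap hk hks hA
  have hpos : 0 < 1 - ∫ t, ‖g t - k t‖ ^ 2 := sub_pos.2 hD
  rw [← neg_div]
  exact (div_le_iff₀ hpos).2 h

/-- `L²` continuity of the distance to a fixed vector along an `L²`-convergent sequence:
`‖gₙ − u‖₂ → 0` implies `‖gₙ − k‖₂ → ‖u − k‖₂` (Minkowski both ways). -/
theorem tendsto_sqrt_integral_norm_sq_sub {g : ℕ → ℝ → ℂ} {u k : ℝ → ℂ}
    (hg : ∀ n, MemLp (g n) 2) (hu : MemLp u 2) (hk : MemLp k 2)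
    (hlim : Tendsto (fun n ↦ ∫ t, ‖g n t - u t‖ ^ 2) atTop (𝓝 0)) :
    Tendsto (fun n ↦ Real.sqrt (∫ t, ‖g n t - k t‖ ^ 2)) atTop
      (𝓝 (Real.sqrt (∫ t, ‖u t - k t‖ ^ 2))) := by
  set Δ : ℝ := Real.sqrt (∫ t, ‖u t - k t‖ ^ 2) with hΔ
  have he : Tendsto (fun n ↦ Real.sqrt (∫ t, ‖g n t - u t‖ ^ 2)) atTop (𝓝 0) := by
    simpa using hlim.sqrt
  have hup : ∀ n, Real.sqrt (∫ t, ‖g n t - k t‖ ^ 2) ≤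
      Real.sqrt (∫ t, ‖g n t - u t‖ ^ 2) + Δ := by
    intro n
    have h := sqrt_integral_norm_sq_sub_le ((hg n).sub hu) (hk.sub hu)
    simp only [Pi.sub_apply] at h
    have e1 : ∀ t, g n t - u t - (k t - u t) = g n t - k t := fun t ↦ by ring
    have e2 : ∀ t, ‖k t - u t‖ = ‖u t - k t‖ := fun t ↦ norm_sub_rev _ _
    simp only [e1, e2] at h
    exact h
  have hlo : ∀ n, Δ ≤ Real.sqrt (∫ t, ‖g n t - u t‖ ^ 2) +
      Real.sqrt (∫ t, ‖g n t - k t‖ ^ 2) := by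
    intro n
    have h := sqrt_integral_norm_sq_sub_le (hu.sub (hg n)) (hk.sub (hg n))
    simp only [Pi.sub_apply] at h
    have e1 : ∀ t, u t - g n t - (k t - g n t) = u t - k t := fun t ↦ by ring
    have e2 : ∀ t, ‖u t - g n t‖ = ‖g n t - u t‖ := fun t ↦ norm_sub_rev _ _
    have e3 : ∀ t, ‖k t - g n t‖ = ‖g n t - k t‖ := fun t ↦ norm_sub_rev _ _
    simp only [e1, e2, e3] at h
    exact h
  refine tendsto_of_tendsto_of_tendsto_of_le_of_le
    (g := fun n ↦ Δ - Real.sqrt (∫ t, ‖g n t - u t‖ ^ 2))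
    (h := fun n ↦ Real.sqrt (∫ t, ‖g n t - u t‖ ^ 2) + Δ) ?_ ?_
    (fun n ↦ by linarith [hlo n]) hup
  · simpa using tendsto_const_nhds.sub he
  · simpa using he.add tendsto_const_nhds

/-- **Bootstrap at the ground state.** For a ground state `u` of the window `[-a, a]` and a test
`k` on the window with `Z₁(k; ·) ≤ A`, writing `Δ = ‖u − k‖₂`:
`ε(a) (1 − Δ²) ≥ −A e^{a/2}√(2a) (‖k‖₂ + 2Δ)` (the near-minimiser bootstrap along the
minimising sequence defining `u`, in the limit). -/
theorem weilGroundEnergy_bootstrap_of_groundState (hu : IsWeilGroundState a u)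
    (hk : IsWeilTest k) (hks : tsupport k ⊆ Icc (-a) a) (hA : ∀ T : ℝ,
      ∑ᶠ ρ ∈ weilZeroIndex T, (riemannZetaZeroOrder ρ : ℝ) * ‖weilMellin k ρ‖ ≤ A) :
    -(A * (Real.exp (a / 2) * Real.sqrt (2 * a)) *
        (Real.sqrt (∫ t, ‖k t‖ ^ 2) + 2 * Real.sqrt (∫ t, ‖u t - k t‖ ^ 2))) ≤
      weilGroundEnergy a * (1 - ∫ t, ‖u t - k t‖ ^ 2) := by
  have ha := hu.pos
  obtain ⟨huL, g, hg, hQ, hL2⟩ := hu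
  set E₀ : ℝ := A * (Real.exp (a / 2) * Real.sqrt (2 * a)) with hE₀
  have hn : ∀ n, -(E₀ * (Real.sqrt (∫ t, ‖k t‖ ^ 2) + 2 * Real.sqrt (∫ t, ‖g n t - k t‖ ^ 2)) +
      ((weilQuadratic (g n)).re - weilGroundEnergy a)) ≤
        weilGroundEnergy a * (1 - ∫ t, ‖g n t - k t‖ ^ 2) := fun n ↦
    weilGroundEnergy_bootstrap_of_near_minimiser (hg n).1 (hg n).2.1 ha.le (by linarith) hk hks hA
  have hgm : ∀ n, MemLp (g n) 2 := fun n ↦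
    (hg n).1.1.continuous.memLp_of_hasCompactSupport (hg n).1.2
  have hkm : MemLp k 2 := hk.1.continuous.memLp_of_hasCompactSupport hk.2
  have hsq := tendsto_sqrt_integral_norm_sq_sub hgm huL hkm hL2
  have hD : Tendsto (fun n ↦ ∫ t, ‖g n t - k t‖ ^ 2) atTop (𝓝 (∫ t, ‖u t - k t‖ ^ 2)) := by
    have e1 : ∀ n, Real.sqrt (∫ t, ‖g n t - k t‖ ^ 2) ^ 2 = ∫ t, ‖g n t - k t‖ ^ 2 := fun n ↦
      Real.sq_sqrt (integral_nonneg fun t ↦ by positivity)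
    have e2 : Real.sqrt (∫ t, ‖u t - k t‖ ^ 2) ^ 2 = ∫ t, ‖u t - k t‖ ^ 2 :=
      Real.sq_sqrt (integral_nonneg fun t ↦ by positivity)
    rw [← e2]
    exact (hsq.pow 2).congr fun n ↦ e1 n
  have hs : Tendsto (fun n ↦ (weilQuadratic (g n)).re - weilGroundEnergy a) atTop (𝓝 0) := by
    simpa using hQ.sub_const (weilGroundEnergy a)
  have hL : Tendsto (fun n ↦ -(E₀ * (Real.sqrt (∫ t, ‖k t‖ ^ 2) +
      2 * Real.sqrt (∫ t, ‖g n t - k t‖ ^ 2)) + ((weilQuadratic (g n)).re - weilGroundEnergy a)))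
      atTop (𝓝 (-(E₀ * (Real.sqrt (∫ t, ‖k t‖ ^ 2) +
        2 * Real.sqrt (∫ t, ‖u t - k t‖ ^ 2)) + 0))) :=
    ((tendsto_const_nhds.mul (tendsto_const_nhds.add (tendsto_const_nhds.mul hsq))).add hs).neg
  have hR : Tendsto (fun n ↦ weilGroundEnergy a * (1 - ∫ t, ‖g n t - k t‖ ^ 2)) atTop
      (𝓝 (weilGroundEnergy a * (1 - ∫ t, ‖u t - k t‖ ^ 2))) :=
    tendsto_const_nhds.mul (tendsto_const_nhds.sub hD)
  have := le_of_tendsto_of_tendsto' hL hR hn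
  simpa using this

/-- **Solved form at the ground state.** If `Δ² = ‖u − k‖₂² < 1` then
`ε(a) ≥ −A e^{a/2}√(2a)(‖k‖₂ + 2Δ)/(1 − Δ²)`. -/
theorem weilGroundEnergy_ge_of_groundState (hu : IsWeilGroundState a u)
    (hk : IsWeilTest k) (hks : tsupport k ⊆ Icc (-a) a) (hA : ∀ T : ℝ,
      ∑ᶠ ρ ∈ weilZeroIndex T, (riemannZetaZeroOrder ρ : ℝ) * ‖weilMellin k ρ‖ ≤ A)
    (hD : ∫ t, ‖u t - k t‖ ^ 2 < 1) :
    -(A * (Real.exp (a / 2) * Real.sqrt (2 * a)) *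
        (Real.sqrt (∫ t, ‖k t‖ ^ 2) + 2 * Real.sqrt (∫ t, ‖u t - k t‖ ^ 2)) /
        (1 - ∫ t, ‖u t - k t‖ ^ 2)) ≤ weilGroundEnergy a := by
  have h := weilGroundEnergy_bootstrap_of_groundState hu hk hks hA
  have hpos : 0 < 1 - ∫ t, ‖u t - k t‖ ^ 2 := sub_pos.2 hD
  rw [← neg_div]
  exact (div_le_iff₀ hpos).2 h

/-- **Invisibility under negative energy.** If `ε(a) < 0`, every window test `k` with
`Z₁(k; ·) ≤ A` satisfies `‖u − k‖₂² ≥ 1 − A e^{a/2}√(2a)(‖k‖₂ + 2‖u − k‖₂)/|ε(a)|`: a ground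
state of negative energy is almost orthogonal to the near-null vectors of the zero pairing. -/
theorem one_sub_le_dist_sq_of_weilGroundEnergy_neg (hu : IsWeilGroundState a u)
    (hk : IsWeilTest k) (hks : tsupport k ⊆ Icc (-a) a) (hA : ∀ T : ℝ,
      ∑ᶠ ρ ∈ weilZeroIndex T, (riemannZetaZeroOrder ρ : ℝ) * ‖weilMellin k ρ‖ ≤ A)
    (hneg : weilGroundEnergy a < 0) :
    1 - A * (Real.exp (a / 2) * Real.sqrt (2 * a)) *
        (Real.sqrt (∫ t, ‖k t‖ ^ 2) + 2 * Real.sqrt (∫ t, ‖u t - k t‖ ^ 2)) /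
        |weilGroundEnergy a| ≤ ∫ t, ‖u t - k t‖ ^ 2 := by
  have h := weilGroundEnergy_bootstrap_of_groundState hu hk hks hA
  have hε : 0 < -weilGroundEnergy a := neg_pos.2 hneg
  rw [abs_of_neg hneg]
  have key : 1 - ∫ t, ‖u t - k t‖ ^ 2 ≤ A * (Real.exp (a / 2) * Real.sqrt (2 * a)) *
      (Real.sqrt (∫ t, ‖k t‖ ^ 2) + 2 * Real.sqrt (∫ t, ‖u t - k t‖ ^ 2)) /
        -weilGroundEnergy a := by
    rw [le_div_iff₀ hε]
    nlinarith [h]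
  linarith

end Bootstrap

end Summit.RiemannHypothesis.RiemannHypothesis.Theorems
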